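import Literature.Combinatorics.StablePolynomials.BasicProofs
import Literature.Combinatorics.StablePolynomials.GraceWalshSzego
import Mathlib.Algebra.MvPolynomial.Equiv
import HarnessLib

/-!
# Stability preservers on polynomials of bounded degree in one variable
# (Borcea–Brändén I, Theorem 1.1, case `n = 1`)

J. Borcea, P. Brändén, *The Lee–Yang and Pólya–Schur programs. I. Linear operators preserving stability*,
Invent. Math. 177 (2009) 541–569 (arXiv:0809.0401), §1.1:

> **Theorem 1.1.** Let `κ ∈ ℕⁿ` and `T : ℂ_κ[z_1,…,z_n] → ℂ[z_1,…,z_n]` be a linear operator. Then `T`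
> preserves stability if and only if either
> (a) `T` has range of dimension at most one and is of the form `T(f) = α(f)P`, where `α` is a linear
> functional on `ℂ_κ[z_1,…,z_n]` and `P` is a stable polynomial, or
> (b) `G_T(z,w) ∈ 𝓗_{2n}(ℂ)`.

Here `G_T(z,w) = T[(z+w)^κ] = Σ_{α ≤ κ} binom(κ,α) T(z^α) w^{κ-α}` (§1.1) and, for `n = 1`, `ℂ_κ[z]` is the
space of polynomials of degree at most `κ`. This file proves the theorem for **`n = 1` and every degree
`κ ≥ 1`** (`boundedDegree_stabilityPreserver_iff`), by the reduction of §2.2 of the paper to the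
multi-affine case `κ = (1,…,1)` in `κ` variables, which is the tree's
`multiAffine_stabilityPreserver_necessity` / `multiAffine_stabilityPreserver_sufficiency`
(`BasicProofs.lean`): §2.2 introduces the polarization `Π↑_κ` and the projection `Π↓_κ` (tree:
`polarization`, `diagonal`, `GraceWalshSzego.lean`) and notes

> "(a) The linear operators `Π↑_κ, Π↓_κ` preserve stability, (b) … `Π↓_κ ∘ Π↑_κ = id`; (c) … Hence many
> questions about linear transformations (not necessarily preserving degrees) reduce to questions about
> linear transformations on multi-affine polynomials,"

(Proposition 2.4 = tree `isUpperHalfPlaneStable_polarization_iff`, the Grace–Walsh–Szegő theorem). "Preserves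
stability" is read, as everywhere in this directory and in the paper (Introduction: "`T(f)` is either stable or
`T(f) ≡ 0`"), as `T(𝓗 ∩ ℂ_κ[z]) ⊆ 𝓗 ∪ {0}`; univariate stability of `p ∈ ℂ[t]` is `p(t) ≠ 0` for `Im t > 0`
(which forces `p ≠ 0`), as in `GraceWalshSzego.lean`.

## The reduction

For `T : ℂ[t] → ℂ[t]` linear and a finite index type `σ` with `|σ| = κ`, `i₀ ∈ σ`, let
`T̃ = ι ∘ T ∘ Π↓ : ℂ[z_σ] → ℂ[z_σ]` (`liftOp`), where `ι(p) = p(z_{i₀})` (Mathlib's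
`Polynomial.toMvPolynomial i₀`, which preserves and reflects stability, `isUpperHalfPlaneStable_toMvPolynomial_iff`).
* `T` preserves stability on `ℂ_κ[t]` iff `T̃` preserves stability on multi-affine polynomials
  (`liftOp_preserves`, `preserves_of_liftOp`; uses `Π↓Π↑ = id` and Prop. 2.4).
* `G_{T̃}(z,w) = T[∏_i (t + w_i)](z_{i₀})` (`eval_multiAffineSymbol_liftOp`), whose diagonal `w_i = w` is
  `G_T(z_{i₀}, w)`; conversely `w ↦ T[∏_i (t + w_i)](z₀)` is the polarization of `w ↦ G_T(z₀,w)`, so by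
  Prop. 2.4 `G_{T̃}` is stable iff `G_T` is (`isUpperHalfPlaneStable_multiAffineSymbol_liftOp_iff`).
* The rank-one alternative transfers through `ι(T p) = T̃(Π↑p)` (`exists_functional_of_liftOp`).

## Contents

* §1 `isUpperHalfPlaneStable_toMvPolynomial_iff`; `liftOp`, `polarizationLin`; `liftOp_preserves`,
  `preserves_of_liftOp`.
* §2 `univariateSymbol κ T = G_T(z,w) ∈ ℂ[z,w]` (variables `Fin 2`), `apply_X_add_C_pow`,
  `eval_univariateSymbol`, `isUpperHalfPlaneStable_univariateSymbol_iff`.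
* §3 `eval_multiAffineSymbol_liftOp`, `isUpperHalfPlaneStable_multiAffineSymbol_liftOp_iff`.
* §4 `exists_functional_of_liftOp`; **`boundedDegree_stabilityPreserver_iff_card`** (any `σ`, `κ = |σ|`) and
  **`boundedDegree_stabilityPreserver_iff`** (Theorem 1.1 for `n = 1`, `κ ≥ 1`).

## References

* [BorceaBranden2009] J. Borcea, P. Brändén, Invent. Math. 177 (2009) 541–569, §1.1 Thm. 1.1, §2.2
  (Π↑, Π↓, Prop. 2.4, "proofs of Theorems 1.1–1.3 reduce to multi-affine polynomials"), §3.
-/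

noncomputable section

open MvPolynomial Finset

namespace Literature.Combinatorics.StablePolynomials

variable {σ : Type*}

/-! ## §1 The embedding `ι`, the operator `T̃ = ι ∘ T ∘ Π↓`, and the transfer of the preserver property -/

section LiftOp

/-- **`ι(p) = p(z_{i₀})` preserves and reflects stability**: `p(z_{i₀}) ∈ 𝓗_σ(ℂ)` iff `p(t) ≠ 0` for
`Im t > 0`. [cite: BorceaBranden2009, §1 (definition of stability: no zeros with all coordinates in the
open upper half-plane)] -/
theorem isUpperHalfPlaneStable_toMvPolynomial_iff (i₀ : σ) (p : Polynomial ℂ) :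
    IsUpperHalfPlaneStable (p.toMvPolynomial i₀) ↔ ∀ t : ℂ, 0 < t.im → p.eval t ≠ 0 := by
  constructor
  · intro h t ht
    have h' := h (fun _ => t) fun _ => ht
    rwa [eval_toMvPolynomial] at h'
  · intro h z hz
    rw [eval_toMvPolynomial]
    exact h _ (hz i₀)

/-- **The multi-affine lift `T̃ = ι ∘ T ∘ Π↓_κ`** of a linear operator `T` on `ℂ[t]` to `ℂ[z_σ]`
(`|σ| = κ`): `T̃(f) = T(Π↓ f)(z_{i₀})`. [cite: BorceaBranden2009, §2.2 ("questions about linear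
transformations … reduce to questions about linear transformations on multi-affine polynomials")] -/
def liftOp (i₀ : σ) (T : Polynomial ℂ →ₗ[ℂ] Polynomial ℂ) : MvPolynomial σ ℂ →ₗ[ℂ] MvPolynomial σ ℂ :=
  (Polynomial.toMvPolynomial i₀ : Polynomial ℂ →ₐ[ℂ] MvPolynomial σ ℂ).toLinearMap ∘ₗ T ∘ₗ
    (diagonal : MvPolynomial σ ℂ →ₐ[ℂ] Polynomial ℂ).toLinearMap

/-- `T̃(f) = ι(T(Π↓ f))`. [cite: BorceaBranden2009, §2.2 (Π↓_κ)] -/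
theorem liftOp_apply (i₀ : σ) (T : Polynomial ℂ →ₗ[ℂ] Polynomial ℂ) (f : MvPolynomial σ ℂ) :
    liftOp i₀ T f = (T (diagonal f)).toMvPolynomial i₀ :=
  rfl

variable [Fintype σ]

/-- **`Π↑_κ` as a linear map** `ℂ[t] → ℂ[z_σ]`. [cite: BorceaBranden2009, §2.2 ("define a (linear)
polarization operator `Π↑_κ`")] -/
def polarizationLin (σ : Type*) [Fintype σ] : Polynomial ℂ →ₗ[ℂ] MvPolynomial σ ℂ where
  toFun := polarization σ
  map_add' := polarization_add
  map_smul' := polarization_smul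

/-- `polarizationLin σ p = Π↑ p`. [cite: BorceaBranden2009, §2.2 (Π↑_κ)] -/
theorem polarizationLin_apply (p : Polynomial ℂ) : polarizationLin σ p = polarization σ p :=
  rfl

variable [DecidableEq σ]

/-- **`T` preserves stability on `ℂ_κ[t]` ⇒ `T̃` preserves stability on multi-affine polynomials**: for
`f` multi-affine stable, `Π↓f` is stable of degree `≤ κ` (its values on `Im t > 0` are values of `f` on the
diagonal of `ℋ^σ`), so `T(Π↓ f) ∈ 𝓗 ∪ {0}` and `T̃ f = ι(T(Π↓f)) ∈ 𝓗 ∪ {0}`.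
[cite: BorceaBranden2009, §2.2 ("(a) The linear operators `Π↑_κ` and `Π↓_κ` preserve stability")] -/
theorem liftOp_preserves (i₀ : σ) (T : Polynomial ℂ →ₗ[ℂ] Polynomial ℂ)
    (hT : ∀ p : Polynomial ℂ, p.natDegree ≤ Fintype.card σ → (∀ t : ℂ, 0 < t.im → p.eval t ≠ 0) →
      (∀ t : ℂ, 0 < t.im → (T p).eval t ≠ 0) ∨ T p = 0)
    {f : MvPolynomial σ ℂ} (hf : IsMultiAffine f) (hs : IsUpperHalfPlaneStable f) :
    IsUpperHalfPlaneStable (liftOp i₀ T f) ∨ liftOp i₀ T f = 0 := by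
  have hds : ∀ t : ℂ, 0 < t.im → (diagonal f).eval t ≠ 0 := fun t ht => by
    rw [eval_diagonal]
    exact hs _ fun _ => ht
  rw [liftOp_apply]
  rcases hT _ (natDegree_diagonal_le hf) hds with h | h
  · exact Or.inl ((isUpperHalfPlaneStable_toMvPolynomial_iff i₀ _).2 h)
  · exact Or.inr (by rw [h, map_zero])

/-- **`T̃` preserves stability on multi-affine polynomials ⇒ `T` preserves stability on `ℂ_κ[t]`**: for
`p ∈ ℂ_κ[t]` stable, `Π↑p` is multi-affine and stable (Prop. 2.4) with `Π↓Π↑p = p`, so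
`ι(T p) = T̃(Π↑ p) ∈ 𝓗 ∪ {0}`. [cite: BorceaBranden2009, §2.2 Prop. 2.4 and (b) "`Π↓_κ ∘ Π↑_κ = id`"] -/
theorem preserves_of_liftOp (i₀ : σ) (T : Polynomial ℂ →ₗ[ℂ] Polynomial ℂ)
    (hT : ∀ f : MvPolynomial σ ℂ, IsMultiAffine f → IsUpperHalfPlaneStable f →
      IsUpperHalfPlaneStable (liftOp i₀ T f) ∨ liftOp i₀ T f = 0)
    {p : Polynomial ℂ} (hp : p.natDegree ≤ Fintype.card σ) (hs : ∀ t : ℂ, 0 < t.im → p.eval t ≠ 0) :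
    (∀ t : ℂ, 0 < t.im → (T p).eval t ≠ 0) ∨ T p = 0 := by
  have h := hT (polarization σ p) (isMultiAffine_polarization p) (isUpperHalfPlaneStable_polarization hp hs)
  rw [liftOp_apply, diagonal_polarization hp] at h
  rcases h with h | h
  · exact Or.inl ((isUpperHalfPlaneStable_toMvPolynomial_iff i₀ _).1 h)
  · exact Or.inr (Polynomial.toMvPolynomial_injective i₀ (by rw [h, map_zero]))

end LiftOp

/-! ## §2 The symbol `G_T(z,w) = T[(t+w)^κ](z)` -/

section Symbol

/-- **The symbol of `T` on `ℂ_κ[t]`**: `G_T(z,w) = T[(z+w)^κ] = Σ_{k ≤ κ} binom(κ,k) T(z^k)(z) w^{κ-k} ∈ ℂ[z,w]`,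
as a polynomial in the two variables `z = X 0`, `w = X 1`. [cite: BorceaBranden2009, §1.1 (definition of
`G_T`, "`G_T(z,w) = T[(z+w)^κ] = Σ_{α ≤ κ} binom(κ,α) T(z^α) w^{κ-α}`")] -/
def univariateSymbol (κ : ℕ) (T : Polynomial ℂ →ₗ[ℂ] Polynomial ℂ) : MvPolynomial (Fin 2) ℂ :=
  ∑ k ∈ range (κ + 1), ((κ.choose k : ℕ) : ℂ) • ((T (Polynomial.X ^ k)).toMvPolynomial 0 * X 1 ^ (κ - k))

/-- `T[(t+w)^κ] = Σ_k binom(κ,k) w^{κ-k} T(t^k)` (binomial theorem and linearity).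
[cite: BorceaBranden2009, §1.1 ("by linearity … `T[(z+w)^κ] = Σ_{α≤κ} binom(κ,α) T(z^α) w^{κ-α}`")] -/
theorem apply_X_add_C_pow (T : Polynomial ℂ →ₗ[ℂ] Polynomial ℂ) (κ : ℕ) (w : ℂ) :
    T ((Polynomial.X + Polynomial.C w) ^ κ) =
      ∑ k ∈ range (κ + 1), (((κ.choose k : ℕ) : ℂ) * w ^ (κ - k)) • T (Polynomial.X ^ k) := by
  rw [add_pow, map_sum]
  refine sum_congr rfl fun k _ => ?_
  rw [← Polynomial.C_eq_natCast, ← Polynomial.C_pow, mul_assoc, ← Polynomial.C_mul, mul_comm,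
    ← Polynomial.smul_eq_C_mul, map_smul, mul_comm (w ^ _)]

/-- **`G_T(z,w) = T[(t+w)^κ](z)`** pointwise. [cite: BorceaBranden2009, §1.1 (definition of `G_T`)] -/
theorem eval_univariateSymbol (κ : ℕ) (T : Polynomial ℂ →ₗ[ℂ] Polynomial ℂ) (zw : Fin 2 → ℂ) :
    eval zw (univariateSymbol κ T) = (T ((Polynomial.X + Polynomial.C (zw 1)) ^ κ)).eval (zw 0) := by
  rw [apply_X_add_C_pow, Polynomial.eval_finsetSum, univariateSymbol, map_sum]
  refine sum_congr rfl fun k _ => ?_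
  rw [smul_eval, _root_.map_mul (eval zw), eval_toMvPolynomial, _root_.map_pow (eval zw), eval_X,
    Polynomial.eval_smul, smul_eq_mul]
  ring

/-- **`G_T ∈ 𝓗_2(ℂ)` iff `T[(t+w)^κ](z) ≠ 0` for `Im z, Im w > 0`.** [cite: BorceaBranden2009, §1.1 Thm. 1.1 (b)] -/
theorem isUpperHalfPlaneStable_univariateSymbol_iff (κ : ℕ) (T : Polynomial ℂ →ₗ[ℂ] Polynomial ℂ) :
    IsUpperHalfPlaneStable (univariateSymbol κ T) ↔
      ∀ z w : ℂ, 0 < z.im → 0 < w.im → (T ((Polynomial.X + Polynomial.C w) ^ κ)).eval z ≠ 0 := by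
  constructor
  · intro h z w hz hw
    have h' := h ![z, w] fun i => by
      fin_cases i
      · exact hz
      · exact hw
    rwa [eval_univariateSymbol] at h'
  · intro h zw hzw
    rw [eval_univariateSymbol]
    exact h _ _ (hzw 0) (hzw 1)

end Symbol

/-! ## §3 The symbol of `T̃` versus `G_T` -/

section LiftSymbol

variable [Fintype σ] [DecidableEq σ]

omit [DecidableEq σ] in
/-- `Π↓ ∏_i (z_i + w_i) = ∏_i (t + w_i)`. [cite: BorceaBranden2009, §2.2 (Π↓_κ)] -/
theorem diagonal_prod_X_add_C (w : σ → ℂ) :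
    diagonal (∏ i, (X i + C (w i)) : MvPolynomial σ ℂ) = ∏ i, (Polynomial.X + Polynomial.C (w i)) := by
  rw [map_prod]
  exact prod_congr rfl fun i _ => by rw [map_add, diagonal_X, diagonal_C]

/-- `T[∏_i (t + w_i)] = Σ_S w^{[κ]∖S} T(t^{|S|})`. [cite: BorceaBranden2009, §1.1 and §2.2 (the symbol of an
operator on multi-affine polynomials, `T[(z+w)^{[n]}] = Σ_S T(z^S) w^{[n]∖S}`)] -/
theorem apply_prod_X_add_C (T : Polynomial ℂ →ₗ[ℂ] Polynomial ℂ) (w : σ → ℂ) :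
    T (∏ i, (Polynomial.X + Polynomial.C (w i))) =
      ∑ S : Finset σ, (∏ i ∈ Sᶜ, w i) • T (Polynomial.X ^ S.card) := by
  rw [← diagonal_prod_X_add_C, prod_X_add_C_eq, map_sum, map_sum]
  refine sum_congr rfl fun S _ => ?_
  rw [map_smul, map_smul, map_prod]
  simp only [diagonal_X, prod_const]

/-- **`G_{T̃}(z,w) = T[∏_i (t + w_i)](z_{i₀})`.** [cite: BorceaBranden2009, §1.1 (`G_T(z,w) = T[(z+w)^κ]`) and
§2.2] -/
theorem eval_multiAffineSymbol_liftOp (i₀ : σ) (T : Polynomial ℂ →ₗ[ℂ] Polynomial ℂ) (z w : σ → ℂ) :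
    eval (Sum.elim z w) (multiAffineSymbol (liftOp i₀ T)) =
      (T (∏ i, (Polynomial.X + Polynomial.C (w i)))).eval (z i₀) := by
  rw [eval_multiAffineSymbol, liftOp_apply, eval_toMvPolynomial, diagonal_prod_X_add_C]

omit [DecidableEq σ] in
/-- `∏_i (t + w) = (t + w)^κ` on the diagonal `w_i = w`. [cite: BorceaBranden2009, §2.2 (Π↓_κ)] -/
theorem prod_X_add_C_const (w : ℂ) :
    (∏ _i : σ, (Polynomial.X + Polynomial.C w) : Polynomial ℂ) =
      (Polynomial.X + Polynomial.C w) ^ Fintype.card σ := by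
  rw [prod_const, card_univ]

/-- **The `w`-polarization of `G_T(z₀,·)`**: for fixed `z₀`, `w ↦ T[∏_i (t + w_i)](z₀)` is the multi-affine
symmetric polynomial `Σ_S T(t^{κ-|S|})(z₀) w^S`. [cite: BorceaBranden2009, §2.2 (Π↑_κ, "`Π↑_κ(f)` …
symmetric and multi-affine")] -/
theorem eval_apply_prod_X_add_C_eq (T : Polynomial ℂ →ₗ[ℂ] Polynomial ℂ) (z₀ : ℂ) (w : σ → ℂ) :
    (T (∏ i, (Polynomial.X + Polynomial.C (w i)))).eval z₀ =
      eval w (multiAffine fun S : Finset σ =>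
        (T (Polynomial.X ^ (Fintype.card σ - S.card))).eval z₀) := by
  rw [apply_prod_X_add_C, Polynomial.eval_finsetSum, eval_multiAffine]
  refine sum_nbij' (fun S => Sᶜ) (fun S => Sᶜ) (by simp) (by simp) (by simp) (by simp) fun S _ => ?_
  rw [Polynomial.eval_smul, smul_eq_mul, card_compl, Nat.sub_sub_self (card_le_univ S), mul_comm]

omit [DecidableEq σ] in
/-- A coefficient form whose coefficients depend only on `|S|` is symmetric.
[cite: BorceaBranden2009, §2.2 ("symmetric polynomials in the variables `z_{i1},…,z_{iκ_i}`")] -/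
theorem rename_equiv_multiAffine_card (b : ℕ → ℂ) (e : Equiv.Perm σ) :
    rename (⇑e) (multiAffine fun S : Finset σ => b S.card) = multiAffine fun S : Finset σ => b S.card := by
  classical
  rw [multiAffine, map_sum]
  refine sum_nbij' (fun S => S.map e.toEmbedding) (fun S => S.map e.symm.toEmbedding) (by simp) (by simp)
    (fun S _ => by ext x; simp) (fun S _ => by ext x; simp) fun S _ => ?_
  rw [_root_.map_mul (rename (⇑e) : MvPolynomial σ ℂ →ₐ[ℂ] MvPolynomial σ ℂ), rename_C,
    _root_.map_prod (rename (⇑e) : MvPolynomial σ ℂ →ₐ[ℂ] MvPolynomial σ ℂ), card_map, prod_map]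
  refine congrArg _ (prod_congr rfl fun i _ => ?_)
  rw [rename_X]
  rfl

omit [DecidableEq σ] in
/-- `Π↓ (Σ_S T(t^{κ-|S|})(z₀) z^S)(w) = T[(t+w)^κ](z₀) = G_T(z₀,w)`: the diagonal of the `w`-polarization.
[cite: BorceaBranden2009, §2.2 ("(b) `Π↓_κ ∘ Π↑_κ = id`")] -/
theorem eval_diagonal_multiAffine_card (T : Polynomial ℂ →ₗ[ℂ] Polynomial ℂ) (z₀ w : ℂ) :
    (diagonal (multiAffine fun S : Finset σ =>
        (T (Polynomial.X ^ (Fintype.card σ - S.card))).eval z₀)).eval w =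
      (T ((Polynomial.X + Polynomial.C w) ^ Fintype.card σ)).eval z₀ := by
  rw [diagonal_multiAffine, Polynomial.eval_finsetSum, apply_X_add_C_pow, Polynomial.eval_finsetSum]
  simp only [Polynomial.eval_mul, Polynomial.eval_C, Polynomial.eval_pow, Polynomial.eval_X,
    Polynomial.eval_smul, smul_eq_mul]
  rw [← powerset_univ, sum_powerset_apply_card
    (f := fun k => (T (Polynomial.X ^ (Fintype.card σ - k))).eval z₀ * w ^ k), card_univ,
    ← sum_range_reflect]
  refine sum_congr rfl fun k hk => ?_
  have hk' : k ≤ Fintype.card σ := Nat.lt_succ_iff.1 (mem_range.1 hk)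
  rw [Nat.add_sub_cancel, Nat.sub_sub_self hk', Nat.choose_symm hk', nsmul_eq_mul]
  ring

/-- **`G_{T̃} ∈ 𝓗_{2κ}(ℂ)` iff `G_T ∈ 𝓗_2(ℂ)`** (`|σ| = κ`): "⇒" by restricting to the diagonal `w_i = w`;
"⇐" because `w ↦ G_{T̃}(z,w)` is the polarization of `w ↦ G_T(z_{i₀},w)`, which is stable of degree `≤ κ`
for `Im z_{i₀} > 0`, and polarization preserves stability (Prop. 2.4, Grace–Walsh–Szegő).
[cite: BorceaBranden2009, §2.2 Prop. 2.4 and "(c) proofs of Theorems 1.1–1.3 reduce to the case of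
multi-affine polynomials"] -/
theorem isUpperHalfPlaneStable_multiAffineSymbol_liftOp_iff (i₀ : σ) (T : Polynomial ℂ →ₗ[ℂ] Polynomial ℂ) :
    IsUpperHalfPlaneStable (multiAffineSymbol (liftOp i₀ T)) ↔
      ∀ z w : ℂ, 0 < z.im → 0 < w.im →
        (T ((Polynomial.X + Polynomial.C w) ^ Fintype.card σ)).eval z ≠ 0 := by
  constructor
  · intro h z w hz hw
    have h' := h (Sum.elim (fun _ => z) fun _ => w) (by rintro (i | i) <;> simpa)
    rwa [eval_multiAffineSymbol_liftOp, prod_X_add_C_const] at h'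
  · intro h zw hzw
    rw [← Sum.elim_comp_inl_inr zw, eval_multiAffineSymbol_liftOp, eval_apply_prod_X_add_C_eq]
    refine isUpperHalfPlaneStable_of_diagonal (isMultiAffine_multiAffine _)
      (fun e => rename_equiv_multiAffine_card
        (fun k => (T (Polynomial.X ^ (Fintype.card σ - k))).eval ((zw ∘ Sum.inl) i₀)) e)
      (fun t ht => ?_) _ fun i => hzw (Sum.inr i)
    rw [eval_diagonal_multiAffine_card]
    exact h _ _ (hzw (Sum.inl i₀)) ht

end LiftSymbol

/-! ## §4 Theorem 1.1 for `n = 1` -/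

section Main

variable [Fintype σ] [DecidableEq σ]

omit [DecidableEq σ] in
/-- **The rank-one alternative transfers from `T̃` to `T`**: if `T̃ f = α̃(f) P̃` on multi-affine `f` with
`P̃` stable, then `T p = α(p) P` on `ℂ_κ[t]` with `P` stable — from `ι(T p) = T̃(Π↑ p)` and the injectivity
of `ι`. [cite: BorceaBranden2009, §1.1 Thm. 1.1 (a) and §2.2 ("(b) `Π↓_κ ∘ Π↑_κ = id`")] -/
theorem exists_functional_of_liftOp (i₀ : σ) (T : Polynomial ℂ →ₗ[ℂ] Polynomial ℂ)
    {α : MvPolynomial σ ℂ →ₗ[ℂ] ℂ} {P : MvPolynomial σ ℂ} (hP : IsUpperHalfPlaneStable P)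
    (hαP : ∀ f : MvPolynomial σ ℂ, IsMultiAffine f → liftOp i₀ T f = α f • P) :
    ∃ (β : Polynomial ℂ →ₗ[ℂ] ℂ) (Q : Polynomial ℂ), (∀ t : ℂ, 0 < t.im → Q.eval t ≠ 0) ∧
      ∀ p : Polynomial ℂ, p.natDegree ≤ Fintype.card σ → T p = β p • Q := by
  have key : ∀ p : Polynomial ℂ, p.natDegree ≤ Fintype.card σ →
      (T p).toMvPolynomial i₀ = α (polarization σ p) • P := fun p hp => by
    rw [← hαP _ (isMultiAffine_polarization p), liftOp_apply, diagonal_polarization hp]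
  by_cases hzero : ∀ p : Polynomial ℂ, p.natDegree ≤ Fintype.card σ → T p = 0
  · refine ⟨0, 1, fun t _ => by rw [Polynomial.eval_one]; exact one_ne_zero, fun p hp => ?_⟩
    rw [hzero p hp, LinearMap.zero_apply, zero_smul]
  push Not at hzero
  obtain ⟨p₀, hp₀, hT0⟩ := hzero
  set c₀ : ℂ := α (polarization σ p₀) with hc₀_def
  have hc₀ : c₀ ≠ 0 := fun h0 =>
    hT0 (Polynomial.toMvPolynomial_injective i₀ (by rw [key p₀ hp₀, ← hc₀_def, h0, zero_smul, map_zero]))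
  have hQs : ∀ t : ℂ, 0 < t.im → (T p₀).eval t ≠ 0 := by
    rw [← isUpperHalfPlaneStable_toMvPolynomial_iff i₀, key p₀ hp₀, smul_eq_C_mul]
    exact (isUpperHalfPlaneStable_C hc₀).mul hP
  refine ⟨c₀⁻¹ • (α ∘ₗ polarizationLin σ), T p₀, hQs, fun p hp => Polynomial.toMvPolynomial_injective i₀ ?_⟩
  rw [key p hp, map_smul, key p₀ hp₀, ← hc₀_def, smul_smul, LinearMap.smul_apply, LinearMap.comp_apply,
    polarizationLin_apply, smul_eq_mul, mul_comm _ c₀, ← mul_assoc, mul_inv_cancel₀ hc₀, one_mul]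

/-- **Borcea–Brändén I, Theorem 1.1 for `n = 1`, degree `κ = |σ|`** (any nonempty finite index type `σ`
carrying the auxiliary variables of the reduction). [cite: BorceaBranden2009, §1.1 Thm. 1.1 (case n = 1)
and §2.2–§3 (its proof via the multi-affine case)] -/
theorem boundedDegree_stabilityPreserver_iff_card (i₀ : σ) (T : Polynomial ℂ →ₗ[ℂ] Polynomial ℂ) :
    (∀ p : Polynomial ℂ, p.natDegree ≤ Fintype.card σ → (∀ t : ℂ, 0 < t.im → p.eval t ≠ 0) →
        (∀ t : ℂ, 0 < t.im → (T p).eval t ≠ 0) ∨ T p = 0) ↔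
      ((∃ (α : Polynomial ℂ →ₗ[ℂ] ℂ) (P : Polynomial ℂ), (∀ t : ℂ, 0 < t.im → P.eval t ≠ 0) ∧
          ∀ p : Polynomial ℂ, p.natDegree ≤ Fintype.card σ → T p = α p • P) ∨
        IsUpperHalfPlaneStable (univariateSymbol (Fintype.card σ) T)) := by
  rw [isUpperHalfPlaneStable_univariateSymbol_iff, ← isUpperHalfPlaneStable_multiAffineSymbol_liftOp_iff i₀]
  constructor
  · intro hT
    rcases multiAffine_stabilityPreserver_necessity (liftOp i₀ T) (fun f hf hs => liftOp_preserves i₀ T hT hf hs)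
      with ⟨α, P, hP, hαP⟩ | hG
    · exact Or.inl (exists_functional_of_liftOp i₀ T hP hαP)
    · exact Or.inr hG
  · rintro (⟨α, P, hP, hαP⟩ | hG) p hp hs
    · rw [hαP p hp]
      by_cases h : α p = 0
      · exact Or.inr (by rw [h, zero_smul])
      · exact Or.inl fun t ht => by
          rw [Polynomial.eval_smul, smul_eq_mul]
          exact mul_ne_zero h (hP t ht)
    · exact preserves_of_liftOp i₀ T
        (fun f hf hs' => multiAffine_stabilityPreserver_sufficiency (liftOp i₀ T) hG hf hs') hp hs

omit [Fintype σ] [DecidableEq σ] in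
/-- **Borcea–Brändén I, Theorem 1.1 for `n = 1` (stability preservers on polynomials of degree at most
`κ`, `κ ≥ 1`).** A linear operator `T` on `ℂ[t]` maps every stable polynomial of degree `≤ κ` to a stable
polynomial or to `0` if and only if either (a) `T(p) = α(p)P` on `ℂ_κ[t]` for a linear functional `α` and a
stable polynomial `P`, or (b) `G_T(z,w) = T[(z+w)^κ] = Σ_{k≤κ} binom(κ,k) T(z^k)(z) w^{κ-k} ∈ 𝓗_2(ℂ)`.
[cite: BorceaBranden2009, §1.1 Thm. 1.1 (case n = 1)] -/
theorem boundedDegree_stabilityPreserver_iff {κ : ℕ} (hκ : 0 < κ) (T : Polynomial ℂ →ₗ[ℂ] Polynomial ℂ) :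
    (∀ p : Polynomial ℂ, p.natDegree ≤ κ → (∀ t : ℂ, 0 < t.im → p.eval t ≠ 0) →
        (∀ t : ℂ, 0 < t.im → (T p).eval t ≠ 0) ∨ T p = 0) ↔
      ((∃ (α : Polynomial ℂ →ₗ[ℂ] ℂ) (P : Polynomial ℂ), (∀ t : ℂ, 0 < t.im → P.eval t ≠ 0) ∧
          ∀ p : Polynomial ℂ, p.natDegree ≤ κ → T p = α p • P) ∨
        IsUpperHalfPlaneStable (univariateSymbol κ T)) := by
  have h := boundedDegree_stabilityPreserver_iff_card (⟨0, hκ⟩ : Fin κ) T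
  simp only [Fintype.card_fin] at h
  exact h

end Main

end Literature.Combinatorics.StablePolynomials

end
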